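import Summits.CriticalPhenomena.PercolationContinuityZ3.Theorems.SahiCISCylinderLE

/-!
# The corrected Definition 4 ⇒ CIS, general laws — I: the slab instances

Cell `prim-sahi`, typer (generation 17); `--supports stmt-CriticalPhenomena-4575`.  No named facts, no sorries.

Towards the converse of `IsCISae.condIncrLastLE` (`SahiCISCylinderLE.lean`) for ARBITRARY laws on `Q_{d+1}` (mixed
atomic / diffuse conditioning marginals).  Almost every comparable pair `a ≤ b` of conditioning points shares its
equal coordinates `S = {i : a_i = b_i}` on a SLAB `{x : x_S = u}` of positive mass and is strictly ordered off `S`.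
This file treats one slab: Besicovitch differentiation of the law restricted to the slab (the generation-11 kernel
machinery through `exists_kernel_anti_of_eventually_cross`), the cross inequality on small slab-balls — which are
weakly comparable sets, so the corrected Definition 4 `CondIncrLastLE` applies —, and identification of the slab
kernel with Mathlib's canonical `condKernel` of the whole law (disintegration kernels are a.e. unique).

* `slab S u = {x : Q_d | x|_S = u}`; `slabLaw μ S u` = law of `(x', x_d)` restricted to `x' ∈ slab`, last coordinate
  read in `ℝ`; `slabLaw_prod`, `fst_slabLaw`.
* `cross_of_ratio`, `eventually_cross_slab` — the cross inequality on `(B̄(a,h) ∩ slab) × (B̄(b,h) ∩ slab)` for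
  `a, b` in the slab strictly ordered off `S`, from `CondIncrLastLE`.
* `restrict_compProd_condKernel_map_coe` — `ν|_slab ⊗ₘ (condKernel.map coe) = slabLaw`.
* **`ae_pair_slab_of_condIncrLastLE`** — for `ν ⊗ ν`-a.e. pair in `slab × slab` strictly ordered off `S`, the
  canonical conditional kernel is stochastically ordered: `condKernel b ([0,y]) ≤ condKernel a ([0,y])`.
The assembly over all slabs is `SahiCISCylinderLEConverse.lean`.

References: Colangelo–Müller–Scarsini 2006, Thm. 4 [ColangeloMullerScarsini2006].  Statements are this work.
-/

noncomputable section

namespace Summit.CriticalPhenomena.PercolationContinuityZ3.Theorems.SahiCIS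

open MeasureTheory ProbabilityTheory Set Filter Topology Metric Function
open Summit.CriticalPhenomena.PercolationContinuityZ3.Theorems.SahiBoxTP2
open scoped ENNReal unitInterval

variable {d : ℕ}

/-! ### Slabs -/

/-- The slab of `Q_d` over `u : S → [0,1]`: the points whose `S`-coordinates are `u`. [this work] -/
def slab (S : Finset (Fin d)) (u : ↥S → I) : Set (Fin d → I) := {x | S.restrict x = u}

/-- Slabs are measurable. [folklore] -/
theorem measurableSet_slab (S : Finset (Fin d)) (u : ↥S → I) : MeasurableSet (slab S u) := by
  change MeasurableSet ((S.restrict : (Fin d → I) → (↥S → I)) ⁻¹' {u})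
  exact (Finset.measurable_restrict S) (measurableSet_singleton u)

/-- Coordinates in `S` of a slab point. [folklore] -/
theorem apply_eq_of_mem_slab {S : Finset (Fin d)} {u : ↥S → I} {x : Fin d → I} (hx : x ∈ slab S u) {i : Fin d}
    (hi : i ∈ S) : x i = u ⟨i, hi⟩ := by
  have := congrFun hx ⟨i, hi⟩
  exact this

/-- Two slab points agree on `S`. [folklore] -/
theorem apply_eq_apply_of_mem_slab {S : Finset (Fin d)} {u : ↥S → I} {x y : Fin d → I} (hx : x ∈ slab S u)
    (hy : y ∈ slab S u) {i : Fin d} (hi : i ∈ S) : x i = y i := by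
  rw [apply_eq_of_mem_slab hx hi, apply_eq_of_mem_slab hy hi]

/-! ### The slab law -/

section SlabLaw

variable (μ : Measure (Fin (d + 1) → I)) (S : Finset (Fin d)) (u : ↥S → I)

/-- The law of `(x', x_d)` restricted to `x' ∈ slab S u`, with `x_d` read in `ℝ`. [this work] -/
def slabLaw : Measure ((Fin d → I) × ℝ) :=
  (((μ.map initLast).restrict (slab S u ×ˢ univ))).map (Prod.map id ((↑) : I → ℝ))

/-- The slab law is finite. [folklore] -/
instance isFiniteMeasure_slabLaw [IsFiniteMeasure μ] : IsFiniteMeasure (slabLaw μ S u) := by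
  unfold slabLaw; infer_instance

/-- Rectangle masses of the slab law. [this work] -/
theorem slabLaw_prod {A : Set (Fin d → I)} (hA : MeasurableSet A) {L : Set ℝ} (hL : MeasurableSet L) :
    slabLaw μ S u (A ×ˢ L) = μ.map initLast ((A ∩ slab S u) ×ˢ (((↑) : I → ℝ) ⁻¹' L)) := by
  rw [slabLaw, Measure.map_apply measurable_prodMap_coe (hA.prod hL), Set.preimage_prod_map_prod, Set.preimage_id,
    Measure.restrict_apply (hA.prod (measurable_subtype_coe hL)), Set.prod_inter_prod, Set.inter_univ]

/-- The first marginal of the slab law is the conditioning marginal restricted to the slab. [this work] -/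
theorem fst_slabLaw : (slabLaw μ S u).fst = (μ.map initLast).fst.restrict (slab S u) := by
  ext A hA
  rw [Measure.fst_apply hA, ← Set.prod_univ, slabLaw_prod μ S u hA MeasurableSet.univ, Set.preimage_univ,
    Measure.restrict_apply hA, Measure.fst_apply (hA.inter (measurableSet_slab S u)), Set.prod_univ]

end SlabLaw

/-! ### The cross inequality on slab-balls -/

/-- From the ratio form on a measurable upper set `U` to the cross form with `Uᶜ`. [this work] -/
theorem cross_of_ratio (ρ : Measure ((Fin d → I) × I)) [IsFiniteMeasure ρ] {A B : Set (Fin d → I)}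
    (hA : MeasurableSet A) (hB : MeasurableSet B) {U : Set I} (hU : MeasurableSet U)
    (key : ρ (A ×ˢ U) * ρ.fst B ≤ ρ (B ×ˢ U) * ρ.fst A) :
    ρ (A ×ˢ U) * ρ (B ×ˢ Uᶜ) ≤ ρ (A ×ˢ Uᶜ) * ρ (B ×ˢ U) := by
  rw [fst_eq_add_prod_compl' ρ hB hU, fst_eq_add_prod_compl' ρ hA hU, mul_add, mul_add,
    mul_comm (ρ (B ×ˢ U)) (ρ (A ×ˢ U))] at key
  have hfin : ρ (A ×ˢ U) * ρ (B ×ˢ U) ≠ ⊤ := ENNReal.mul_ne_top (measure_ne_top _ _) (measure_ne_top _ _)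
  have h := (ENNReal.add_le_add_iff_left hfin).1 key
  rw [mul_comm (ρ (B ×ˢ U))] at h
  exact h

/-- For centres strictly ordered on the coordinates of `T`, small sup-balls are strictly separated there. [folklore] -/
theorem eventually_hiCorner_lt_loCorner_on {a b : Fin d → I} {T : Set (Fin d)} (hab : ∀ i ∈ T, a i < b i) :
    ∀ᶠ h in 𝓝[>] (0 : ℝ), ∀ i ∈ T, hiCorner a h i < loCorner b h i := by
  have hgap : ∀ i, ∀ᶠ h in 𝓝 (0 : ℝ), i ∈ T → 2 * h < (b i : ℝ) - a i := fun i => by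
    by_cases hi : i ∈ T
    · have hpos : (0 : ℝ) < ((b i : ℝ) - a i) / 2 := by
        have := Subtype.coe_lt_coe.2 (hab i hi); linarith
      exact (eventually_lt_nhds hpos).mono fun h hh _ => by linarith
    · exact Eventually.of_forall fun _ h' => absurd h' hi
  have h1 : ∀ᶠ h in 𝓝[>] (0 : ℝ), ∀ i, i ∈ T → 2 * h < (b i : ℝ) - a i :=
    eventually_nhdsWithin_of_eventually_nhds (Filter.eventually_all.2 hgap)
  filter_upwards [h1, self_mem_nhdsWithin] with h hh hpos i hi
  have hpos' : 0 < h := hpos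
  have h0a := (a i).2.1
  have h1b := (b i).2.2
  apply Subtype.coe_lt_coe.1
  simp only [hiCorner, loCorner, coe_projIcc]
  have e1 : max (0 : ℝ) (min 1 ((a i : ℝ) + h)) ≤ (a i : ℝ) + h := max_le (by linarith) (min_le_right _ _)
  have e2 : (b i : ℝ) - h ≤ max (0 : ℝ) (min 1 ((b i : ℝ) - h)) := le_max_of_le_right (le_min (by linarith) le_rfl)
  have := hh i hi
  linarith

/-- Slab-balls around slab points strictly ordered off `S` are weakly comparable sets once the balls are strictly
separated off `S`. [this work] -/
theorem slabBall_le_slabBall {S : Finset (Fin d)} {u : ↥S → I} {a b : Fin d → I} {h : ℝ} (hh : 0 ≤ h)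
    (hsep : ∀ i ∉ S, hiCorner a h i < loCorner b h i) :
    ∀ x ∈ closedBall a h ∩ slab S u, ∀ y ∈ closedBall b h ∩ slab S u, x ≤ y := by
  intro x hx y hy i
  by_cases hi : i ∈ S
  · exact (apply_eq_apply_of_mem_slab hx.2 hy.2 hi).le
  · have hx' : x ∈ Icc (loCorner a h) (hiCorner a h) := by rw [← closedBall_eq_Icc a hh]; exact hx.1
    have hy' : y ∈ Icc (loCorner b h) (hiCorner b h) := by rw [← closedBall_eq_Icc b hh]; exact hy.1
    exact (hx'.2 i).trans ((le_of_lt (hsep i hi)).trans (hy'.1 i))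

/-- **The cross inequality on small slab-balls** from the corrected Definition 4. [this work] -/
theorem eventually_cross_slab (μ : Measure (Fin (d + 1) → I)) [IsProbabilityMeasure μ] (hC : CondIncrLastLE μ)
    (S : Finset (Fin d)) (u : ↥S → I) {a b : Fin d → I} (ha : a ∈ slab S u) (hb : b ∈ slab S u)
    (hab : ∀ i ∉ S, a i < b i) :
    ∀ᶠ h in 𝓝[>] (0 : ℝ), ∀ q : ℝ,
      slabLaw μ S u (closedBall a h ×ˢ Ioi q) * slabLaw μ S u (closedBall b h ×ˢ Iic q) ≤
        slabLaw μ S u (closedBall a h ×ˢ Iic q) * slabLaw μ S u (closedBall b h ×ˢ Ioi q) := by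
  have _ := ha; have _ := hb
  filter_upwards [eventually_hiCorner_lt_loCorner_on (T := {i | i ∉ S}) (fun i hi => hab i hi),
    self_mem_nhdsWithin] with h hsep hpos q
  have hh : 0 ≤ h := le_of_lt hpos
  set ρ := μ.map initLast with hρ
  have hAm : MeasurableSet (closedBall a h ∩ slab S u) := measurableSet_closedBall.inter (measurableSet_slab S u)
  have hBm : MeasurableSet (closedBall b h ∩ slab S u) := measurableSet_closedBall.inter (measurableSet_slab S u)
  have hUm : MeasurableSet (((↑) : I → ℝ) ⁻¹' Ioi q) := measurable_subtype_coe measurableSet_Ioi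
  have hUup : IsUpperSet (((↑) : I → ℝ) ⁻¹' Ioi q) := fun v w hvw hv =>
    lt_of_lt_of_le (show q < (v : ℝ) from hv) (Subtype.coe_le_coe.2 hvw)
  have hLU : ((↑) : I → ℝ) ⁻¹' Iic q = (((↑) : I → ℝ) ⁻¹' Ioi q)ᶜ := by ext v; simp [not_lt]
  rw [slabLaw_prod μ S u measurableSet_closedBall measurableSet_Ioi,
    slabLaw_prod μ S u measurableSet_closedBall measurableSet_Iic,
    slabLaw_prod μ S u measurableSet_closedBall measurableSet_Iic,
    slabLaw_prod μ S u measurableSet_closedBall measurableSet_Ioi, hLU]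
  exact cross_of_ratio ρ hAm hBm hUm
    (hC hAm hBm (slabBall_le_slabBall hh fun i hi => hsep i hi) hUup hUm)

/-! ### The canonical kernel disintegrates the slab law -/

/-- `ν|_slab ⊗ₘ (condKernel read in ℝ) = slabLaw`. [this work] -/
theorem restrict_compProd_condKernel_map_coe (μ : Measure (Fin (d + 1) → I)) [IsProbabilityMeasure μ]
    (S : Finset (Fin d)) (u : ↥S → I) :
    ((μ.map initLast).fst.restrict (slab S u)) ⊗ₘ ((μ.map initLast).condKernel.map ((↑) : I → ℝ)) =
      slabLaw μ S u := by
  set ρ := μ.map initLast with hρ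
  haveI : IsMarkovKernel (ρ.condKernel.map ((↑) : I → ℝ)) := Kernel.IsMarkovKernel.map _ measurable_subtype_coe
  haveI : IsFiniteMeasure (ρ.fst.restrict (slab S u)) := inferInstance
  refine ext_of_generate_finite _ generateFrom_prod.symm isPiSystem_prod (fun s hs => ?_) ?_
  · obtain ⟨A, hA, L, hL, rfl⟩ := hs
    have hA' : MeasurableSet A := hA
    have hL' : MeasurableSet L := hL
    rw [Measure.compProd_apply_prod hA' hL', Measure.restrict_restrict hA', slabLaw_prod μ S u hA' hL']
    have h1 : ∫⁻ a in A ∩ slab S u, (ρ.condKernel.map ((↑) : I → ℝ)) a L ∂ρ.fst =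
        ∫⁻ a in A ∩ slab S u, ρ.condKernel a (((↑) : I → ℝ) ⁻¹' L) ∂ρ.fst :=
      setLIntegral_congr_fun (hA'.inter (measurableSet_slab S u)) fun a _ =>
        Kernel.map_apply' _ measurable_subtype_coe a hL'
    rw [h1, ← Measure.compProd_apply_prod (hA'.inter (measurableSet_slab S u)) (measurable_subtype_coe hL'),
      ρ.disintegrate ρ.condKernel]
  · rw [Measure.compProd_apply_univ, ← Set.univ_prod_univ, slabLaw_prod μ S u MeasurableSet.univ MeasurableSet.univ,
      Measure.restrict_apply MeasurableSet.univ, Set.univ_inter, Set.preimage_univ,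
      Measure.fst_apply (measurableSet_slab S u), Set.prod_univ]

/-! ### The slab instance -/

/-- **One slab**: for `ν|_slab ⊗ ν|_slab`-almost every pair of slab points strictly ordered off `S`, the canonical
conditional kernel is stochastically ordered. [this work] -/
theorem ae_pair_slab_of_condIncrLastLE (μ : Measure (Fin (d + 1) → I)) [IsProbabilityMeasure μ]
    (hC : CondIncrLastLE μ) (S : Finset (Fin d)) (u : ↥S → I) :
    ∀ᵐ p ∂((μ.map initLast).fst.prod (μ.map initLast).fst), p.1 ∈ slab S u → p.2 ∈ slab S u →
      (∀ i ∉ S, p.1 i < p.2 i) →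
        ∀ y : I, (μ.map initLast).condKernel p.2 (Iic y) ≤ (μ.map initLast).condKernel p.1 (Iic y) := by
  set ρ := μ.map initLast with hρ
  set ν := ρ.fst with hν
  set νs := ν.restrict (slab S u) with hνs
  obtain ⟨κ₁, hκ₁, hdis₁, hmono₁⟩ := exists_kernel_anti_of_eventually_cross (slabLaw μ S u)
  have hfst : (slabLaw μ S u).fst = νs := fst_slabLaw μ S u
  rw [hfst] at hdis₁
  -- both `κ₁` and `condKernel.map coe` disintegrate the slab law over `νs`: they agree `νs`-a.e.
  haveI : IsMarkovKernel (ρ.condKernel.map ((↑) : I → ℝ)) := Kernel.IsMarkovKernel.map _ measurable_subtype_coe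
  have h0 : νs ⊗ₘ (ρ.condKernel.map ((↑) : I → ℝ)) = slabLaw μ S u := restrict_compProd_condKernel_map_coe μ S u
  have heq : ∀ᵐ a ∂νs, κ₁ a = (ρ.condKernel.map ((↑) : I → ℝ)) a := by
    have e1 : ∀ᵐ a ∂νs, κ₁ a = (slabLaw μ S u).condKernel a := by
      have := eq_condKernel_of_measure_eq_compProd κ₁ (show slabLaw μ S u = (slabLaw μ S u).fst ⊗ₘ κ₁ by
        rw [hfst]; exact hdis₁.symm)
      rwa [hfst] at this
    have e2 : ∀ᵐ a ∂νs, (ρ.condKernel.map ((↑) : I → ℝ)) a = (slabLaw μ S u).condKernel a := by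
      have := eq_condKernel_of_measure_eq_compProd (ρ.condKernel.map ((↑) : I → ℝ))
        (show slabLaw μ S u = (slabLaw μ S u).fst ⊗ₘ _ by rw [hfst]; exact h0.symm)
      rwa [hfst] at this
    filter_upwards [e1, e2] with a h1 h2 using h1.trans h2.symm
  -- the a.e. statement over `νs ⊗ νs`
  have hgood : ∀ᵐ a ∂νs, a ∈ goodSet₀ (slabLaw μ S u) := by rw [← hfst]; exact ae_mem_goodSet₀
  have hmem : ∀ᵐ a ∂νs, a ∈ slab S u := ae_restrict_mem (measurableSet_slab S u)
  have key : ∀ᵐ p ∂(νs.prod νs), (∀ i ∉ S, p.1 i < p.2 i) →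
      ∀ y : I, ρ.condKernel p.2 (Iic y) ≤ ρ.condKernel p.1 (Iic y) := by
    filter_upwards [ae_prod_fst_mem (ν := νs) hgood, ae_prod_snd_mem (μ := νs) hgood,
      ae_prod_fst_mem (ν := νs) hmem, ae_prod_snd_mem (μ := νs) hmem,
      ae_prod_fst_mem (ν := νs) heq, ae_prod_snd_mem (μ := νs) heq] with p hg1 hg2 hm1 hm2 he1 he2 hstrict y
    have h := hmono₁ hg1 hg2 (eventually_cross_slab μ hC S u hm1 hm2 hstrict) (y : ℝ)
    have hev : ∀ a : Fin d → I, κ₁ a = (ρ.condKernel.map ((↑) : I → ℝ)) a →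
        κ₁ a (Iic (y : ℝ)) = ρ.condKernel a (Iic y) := fun a ha => by
      rw [ha, Kernel.map_apply' _ measurable_subtype_coe a measurableSet_Iic, coe_preimage_Iic_of_mem y.2.1 y.2.2,
        Set.Icc_bot]
    rwa [hev p.1 he1, hev p.2 he2] at h
  -- back to `ν ⊗ ν`
  rw [hνs, Measure.prod_restrict, ae_restrict_iff' ((measurableSet_slab S u).prod (measurableSet_slab S u))] at key
  filter_upwards [key] with p hp h1 h2
  exact hp ⟨h1, h2⟩

end Summit.CriticalPhenomena.PercolationContinuityZ3.Theorems.SahiCIS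

end
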